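import Literature.AnabelianGeometry.EtaleTheta.LogDivisorModelTateTowerKummerTwistTower
import Literature.AnabelianGeometry.SemiGraphs.CosetCategories

/-!
# [EtTh] §3 p.72 / Prop. 3.4 (ii): the NON-CONSTANT constant-field functor `D₀ → D^cnst = 𝓑(G_K)⁰` of the ζ-TWISTED
# Kummer–Tate tower — `Y ↦ Spec K_Y`, `K_Y` = the constants of `Y`

S. Mochizuki, *The étale theta function …*, Publ. RIMS **45** (2009) [MochizukiEtTh2009], §3 p.72 («`D^cnst := B(Spec K)⁰` …
the natural surjection `Π^tp_X ↠ G_K` determines a natural functor `D₀ → D^cnst`»), Prop. 3.4 (ii) p.74 («`L^× ⥲ F₀(Y^log)`»,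
`Spec L` = the image of `Y^log` in `D^cnst`), Thm. 3.7 (iii) p.79 [cite: MochizukiEtTh2009, Prop 3.4 (ii) p.74].

CLASS (b) CONSTRUCTION (abc-iut cell, layer L2; abc-iut-L2-lead gen 7 rows R914/R921/R936 «PROP34CNST₀ WITH NON-CONSTANT `D^cnst` AT THE
TWISTED TOWER» — row holder abc-iut-w6-d057 gen 4, this «constants-stabiliser quotient» design = the lead's SPEC OF RECORD (R936), file
prepared by abc-iut-w5-d179 gen 8; consumed BY NAME, nothing landed is edited or restated: abc-iut-L1-t6's group
`TateTowerKummerTwist.Grp = (K ⋊_χ C) × ℤ_γ` / `Compat` / `lvlC` (p471292, p472997), abc-iut-L2-d2's tower `towerC` with its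
level-`n` characters `chiN n` on `μ_{N n}` and inclusions `up` (p478618), the coset category `CosetCat` of [FrdII] Ex. 1.3 (i)).

WHY.  At the ζ-twisted tower the roots of unity recorded in the constant fields MOVE under the Galois group, so the naturality
clauses `DivisorMonoids.Prop34Cnst₀` of Prop. 3.4 (ii) FAIL for every CONSTANT functor `D^cnst` (abc-iut-L2-d2,
`TateTowerKummerTwist.not_prop34Cnst₀_const`, p483973): print's GENUINE functor `Y ↦ Spec K_Y` is needed.  This file constructs it
for the model, base-point-free in its values and independent of choices in its laws:
* `toCst : Compat →* C` — the constant-field coordinate (`Π ↠ G_K`; the model's `G_K` acts on constants through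
  `C = ∏_n (ℤ/M_n)ˣ`, abc-iut-L1-t6's constant-field factor, by the level-wise cyclotomic characters `chiN`);
* `fixedRoots Y i ⊆ μ_{N i}` — the roots of unity of level `i` DEFINED OVER `K_Y`: those fixed by the character of every point
  stabiliser of the connected tempered covering `Y` (for `i = lvl Y` they are exactly the values at a point of the unit constants
  `Ker(B₀(Y) → Φ₀(Y)^gp)`, cf. the proof-only companion);
* `cnstStab Y ≤ C` — «`Gal(K̄/K_Y)`»: the characters fixing every root of unity of `K_Y` of every level `≤ lvl Y`; OPEN
  (`isOpen_cnstStab`: finitely many discrete coordinates), contains the image of every point stabiliser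
  (`toCst_mem_cnstStab_of_ρ_eq`), and is MONOTONE along covering maps (`cnstStab_mono`: `Y → Y'` ⇒ `K_{Y'} ⊆ K_Y`);
  for COMPATIBLE characters membership is decided at the top level alone (`toCst_mem_cnstStab_iff`, via `up_chiN`);
* **`cnst : B^temp(Compat)⁰ ⥤ CosetCat C`**, `Y ↦ C/cnstStab Y = Spec K_Y`, `(f : Y → Y') ↦ (c ↦ c·χ(t))` for ANY transporter `t`
  of base points (`pt_cnst_map`: independent of `t`); functor laws PROVED; **`cnst_map_eq_iff`**: two covering maps `g, g' : Y → Y'`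
  with transporters `a, a'` have the same image in `D^cnst` iff `χ(a⁻¹a') ∈ cnstStab Y'`.
The three clauses of `Prop34Cnst₀ (DivisorMonoids.ofTower towerC) cnst` are PROVED in the proof-only companion
`Discharge/Sec3Prop34Cnst0KummerTwistTower.lean`; the target `CosetCat C` (`C` compact) is the shape consumed by the Thm. 3.7 knits
(`thm37_ofRankOneObjectR_of_inputs`, `D^cnst = 𝓑(G_K)⁰`).
HONEST LABEL: a class-(b) combinatorial DESIGN model (the model's `G_K` is the constant-field factor `C`, acting on roots of unity
only); `K_Y` is read as «`K` with the roots of unity of `F₀(Y)` adjoined» — every model constant extension is abelian; nothing here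
bears on [IUTchIII] Cor. 3.12; no side taken; typed ≠ proved.
-/

noncomputable section

namespace Literature.AnabelianGeometry.EtaleTheta

open CategoryTheory Function Literature.AlgebraicGeometry.Frobenioids Literature.AlgebraicGeometry.Frobenioids.QuasiTemperoid
  Literature.AnabelianGeometry.SemiGraphs LogDivisorTower

namespace TateTowerKummerTwist

/-! ## §1 The constant-field coordinate and the roots of unity defined over `K_Y` -/

/-- **The constant-field coordinate** `Compat → C`, `g ↦ g_C` (the model's `Π^tp_X ↠ G_K`: the Galois group acts on the constants of
every level through `C` by the characters `chiN n`). [cite: MochizukiEtTh2009, Def 3.3 p.72] -/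
def toCst : Compat →* Cst :=
  SemidirectProduct.rightHom.comp ((MonoidHom.fst KC (Multiplicative ℤ)).comp compat.subtype)

/-- `toCst g` is the `C`-coordinate of `g`. [cite: MochizukiEtTh2009, Def 3.3 p.72] -/
@[simp] theorem toCst_apply (g : Compat) : toCst g = (g : Grp).1.right := rfl

/-- The inclusions of roots of unity are injective (multiplicative form of `upAdd_injective`). [cite: MochizukiEtTh2009, §1 p.13] -/
theorem up_injective {i j : ℕ} (h : i ≤ j) : Injective (up h) := fun _ _ hab =>
  Multiplicative.toAdd.injective (upAdd_injective h (congrArg Multiplicative.toAdd hab))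

/-- For a COMPATIBLE element the characters commute with the inclusion of roots of unity (`up_chiN` in `toCst` form).
[cite: MochizukiEtTh2009, §1 p.13] -/
theorem up_chiN_toCst {i j : ℕ} (h : i ≤ j) (g : Compat) (ζ : MuN i) :
    up h (chiN i (toCst g) ζ) = chiN j (toCst g) (up h ζ) :=
  up_chiN h g ζ

/-- The level-`i` characters of two elements of `C` commute (they act through the commutative group `(ℤ/N_i)ˣ`).
[cite: MochizukiEtTh2009, §1 p.13] -/
theorem chiN_comm (i : ℕ) (c c' : Cst) (ζ : MuN i) : chiN i c (chiN i c' ζ) = chiN i c' (chiN i c ζ) :=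
  Multiplicative.toAdd.injective (by rw [toAdd_chiN, toAdd_chiN, toAdd_chiN, toAdd_chiN, mul_left_comm])

/-- **The roots of unity of level `i` defined over the constant field `K_Y`** of a connected tempered covering `Y`: those fixed by
the character of every element of every point stabiliser. [cite: MochizukiEtTh2009, Prop 3.4 (ii) p.74] -/
def fixedRoots (Y : ConnectedPart (BTemp Compat)) (i : ℕ) : Set (MuN i) :=
  {ζ | ∀ (g : Compat) (y : (gset Y).V), (gset Y).ρ g y = y → chiN i (toCst g) ζ = ζ}

/-- Membership in `fixedRoots`. [cite: MochizukiEtTh2009, Prop 3.4 (ii) p.74] -/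
theorem mem_fixedRoots_iff (Y : ConnectedPart (BTemp Compat)) (i : ℕ) (ζ : MuN i) :
    ζ ∈ fixedRoots Y i ↔ ∀ (g : Compat) (y : (gset Y).V), (gset Y).ρ g y = y → chiN i (toCst g) ζ = ζ := Iff.rfl

/-- Along a covering map `Y → Y'` the constants of `Y'` are constants of `Y` (`K_{Y'} ⊆ K_Y`): point stabilisers of `Y` stabilise
the image points. [cite: MochizukiEtTh2009, Prop 3.4 (ii) p.74] -/
theorem fixedRoots_anti {Y Y' : ConnectedPart (BTemp Compat)} (f : Y ⟶ Y') (i : ℕ) : fixedRoots Y' i ⊆ fixedRoots Y i :=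
  fun _ hζ g y hy => hζ g (f.hom.hom.hom y) (by rw [← BTempConnected.hom_ρ f.hom, hy])

/-- The inclusion of roots of unity identifies the constants of `Y` of level `i` with those of level `j ≥ i` in its image (the
stabilisers are COMPATIBLE elements). [cite: MochizukiEtTh2009, §1 p.13] -/
theorem up_mem_fixedRoots_iff (Y : ConnectedPart (BTemp Compat)) {i j : ℕ} (h : i ≤ j) (ζ : MuN i) :
    up h ζ ∈ fixedRoots Y j ↔ ζ ∈ fixedRoots Y i := by
  refine ⟨fun hζ g y hy => up_injective h ?_, fun hζ g y hy => ?_⟩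
  · rw [up_chiN_toCst, hζ g y hy]
  · rw [← up_chiN_toCst, hζ g y hy]

/-! ## §2 `Gal(K̄/K_Y) ≤ C` and the object `Spec K_Y` of `𝓑(C)⁰` -/

/-- **`cnstStab Y = Gal(K̄/K_Y)`**: the elements of `C` whose characters fix every root of unity defined over `K_Y`, at every level
`≤ lvl Y`. [cite: MochizukiEtTh2009, Def 3.3 p.72] -/
def cnstStab (Y : ConnectedPart (BTemp Compat)) : Subgroup Cst where
  carrier := {c | ∀ i ≤ lvlC Y, ∀ ζ ∈ fixedRoots Y i, chiN i c ζ = ζ}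
  mul_mem' {a b} ha hb i hi ζ hζ := by
    show chiN i (a * b) ζ = ζ
    rw [map_mul, MulAut.mul_apply, hb i hi ζ hζ, ha i hi ζ hζ]
  one_mem' i _ ζ _ := by
    show chiN i 1 ζ = ζ
    rw [map_one, MulAut.one_apply]
  inv_mem' {a} ha i hi ζ hζ := by
    show chiN i a⁻¹ ζ = ζ
    conv_lhs => rw [← ha i hi ζ hζ]
    rw [← MulAut.mul_apply, ← map_mul, inv_mul_cancel, map_one, MulAut.one_apply]

/-- Membership in `cnstStab`. [cite: MochizukiEtTh2009, Def 3.3 p.72] -/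
theorem mem_cnstStab_iff (Y : ConnectedPart (BTemp Compat)) (c : Cst) :
    c ∈ cnstStab Y ↔ ∀ i ≤ lvlC Y, ∀ ζ ∈ fixedRoots Y i, chiN i c ζ = ζ := Iff.rfl

/-- **Point stabilisers map into `Gal(K̄/K_Y)`** (`H ↦ G_{K_Y}` under `Π ↠ G_K`). [cite: MochizukiEtTh2009, Def 3.3 p.72] -/
theorem toCst_mem_cnstStab_of_ρ_eq (Y : ConnectedPart (BTemp Compat)) {g : Compat} {y : (gset Y).V}
    (h : (gset Y).ρ g y = y) : toCst g ∈ cnstStab Y :=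
  fun _ _ _ hζ => hζ g y h

/-- **Monotonicity along covering maps**: `Y → Y'` gives `Gal(K̄/K_Y) ≤ Gal(K̄/K_{Y'})`, i.e. `K_{Y'} ⊆ K_Y` (levels drop along
covering maps, constants pull back to constants). [cite: MochizukiEtTh2009, Prop 3.4 (ii) p.74] -/
theorem cnstStab_mono {Y Y' : ConnectedPart (BTemp Compat)} (f : Y ⟶ Y') : cnstStab Y ≤ cnstStab Y' :=
  fun _ hc i hi ζ hζ => hc i (hi.trans (lvlC_le_of_hom f)) ζ (fixedRoots_anti f i hζ)

/-- **For a compatible element membership in `Gal(K̄/K_Y)` is decided at the level of `Y` alone**: `χ(g)` fixes the constants of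
`Y` iff `χ_{lvl Y}(g)` fixes the roots of unity of level `lvl Y` defined over `K_Y`. [cite: MochizukiEtTh2009, §1 p.13] -/
theorem toCst_mem_cnstStab_iff (Y : ConnectedPart (BTemp Compat)) (g : Compat) :
    toCst g ∈ cnstStab Y ↔ ∀ ζ ∈ fixedRoots Y (lvlC Y), chiN (lvlC Y) (toCst g) ζ = ζ := by
  refine ⟨fun h ζ hζ => h _ le_rfl ζ hζ, fun h i hi ζ hζ => up_injective hi ?_⟩
  rw [up_chiN_toCst]
  exact h _ ((up_mem_fixedRoots_iff Y hi ζ).2 hζ)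

/-- `cnstStab Y` as an intersection of finitely many coordinate conditions. [cite: MochizukiEtTh2009, Def 3.3 p.72] -/
theorem coe_cnstStab_eq (Y : ConnectedPart (BTemp Compat)) :
    (cnstStab Y : Set Cst) = ⋂ i ∈ Set.Iic (lvlC Y), (fun c : Cst => c i) ⁻¹'
      {u | ∀ ζ ∈ fixedRoots Y i, LogDivisorModel.TateTowerTwist.zmodChar (N i) (Units.map (castN i).toMonoidHom u) ζ = ζ} := by
  ext c
  rw [Set.mem_iInter₂]
  exact Iff.rfl

/-- **`Gal(K̄/K_Y)` is OPEN in `C`** (it is cut out by finitely many coordinates with values in finite discrete groups).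
[cite: MochizukiEtTh2009, Def 3.3 p.72] -/
theorem isOpen_cnstStab (Y : ConnectedPart (BTemp Compat)) : IsOpen (cnstStab Y : Set Cst) := by
  rw [coe_cnstStab_eq]
  exact (Set.finite_Iic _).isOpen_biInter fun i _ => (isOpen_discrete _).preimage (continuous_apply i)

/-- `Gal(K̄/K_Y)` as an open subgroup of `C`. [cite: MochizukiEtTh2009, Def 3.3 p.72] -/
def cnstStabOpen (Y : ConnectedPart (BTemp Compat)) : OpenSubgroup Cst := ⟨cnstStab Y, isOpen_cnstStab Y⟩

/-- Membership in `cnstStabOpen` is membership in `cnstStab`. [cite: MochizukiEtTh2009, Def 3.3 p.72] -/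
@[simp] theorem mem_cnstStabOpen_iff (Y : ConnectedPart (BTemp Compat)) (c : Cst) : c ∈ cnstStabOpen Y ↔ c ∈ cnstStab Y :=
  Iff.rfl

/-- **`Y^cnst = Spec K_Y`** as an object of `D^cnst = 𝓑(C)⁰` (the coset category: the `C`-set `C/Gal(K̄/K_Y) = Gal(K_Y/K)`).
[cite: MochizukiEtTh2009, Thm 3.7 (iii) p.79] -/
def cnstObj (Y : ConnectedPart (BTemp Compat)) : CosetCat Cst := ⟨cnstStabOpen Y⟩

/-! ## §3 The functor `D₀ → D^cnst` -/

/-- A base point of a connected tempered covering (connected objects of `B^temp` are nonempty). [cite: MochizukiFrdII2008, Ex 1.3 (ii) p.11] -/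
def bpt (Y : ConnectedPart (BTemp Compat)) : (gset Y).V := (BTempConnected.nonempty_of_isConnectedObj Y.obj Y.property).some

/-- Every covering map of connected tempered coverings has a TRANSPORTER of base points: `t · p_{Y'} = f(p_Y)`.
[cite: MochizukiFrdII2008, Ex 1.3 (ii) p.11] -/
theorem exists_transp {Y Y' : ConnectedPart (BTemp Compat)} (f : Y ⟶ Y') :
    ∃ t : Compat, (gset Y').ρ t (bpt Y') = f.hom.hom.hom (bpt Y) :=
  BTempConnected.exists_ρ_eq_of_isConnectedObj Y'.obj Y'.property _ _

/-- A chosen transporter of base points along `f`. [cite: MochizukiFrdII2008, Ex 1.3 (ii) p.11] -/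
def transp {Y Y' : ConnectedPart (BTemp Compat)} (f : Y ⟶ Y') : Compat := (exists_transp f).choose

/-- The defining property of the chosen transporter. [cite: MochizukiFrdII2008, Ex 1.3 (ii) p.11] -/
theorem ρ_transp {Y Y' : ConnectedPart (BTemp Compat)} (f : Y ⟶ Y') : (gset Y').ρ (transp f) (bpt Y') = f.hom.hom.hom (bpt Y) :=
  (exists_transp f).choose_spec

/-- Two transporters to the SAME point have the same image in `Gal(K_{Y'}/K) = C/Gal(K̄/K_{Y'})` (they differ by a stabiliser).
[cite: MochizukiEtTh2009, Def 3.3 p.72] -/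
theorem coe_toCst_eq_of_ρ_eq (Y' : ConnectedPart (BTemp Compat)) {t t' : Compat} {y : (gset Y').V}
    (h : (gset Y').ρ t y = (gset Y').ρ t' y) : ((toCst t : Cst) : (cnstObj Y').carrier) = (toCst t' : Cst) := by
  rw [QuotientGroup.eq, ← map_inv, ← map_mul]
  refine toCst_mem_cnstStab_of_ρ_eq Y' (y := y) ?_
  rw [BTempConnected.ρ_mul_apply Y'.obj, ← h, BTempConnected.ρ_inv_apply Y'.obj]

/-- **`cnst` on a covering map** `f : Y → Y'`: the `C`-map `C/Gal(K̄/K_Y) → C/Gal(K̄/K_{Y'})`, `c ↦ c·χ(t)` for a transporter `t` of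
base points (well defined: `Gal(K̄/K_Y) ≤ Gal(K̄/K_{Y'})`, `C` commutative). [cite: MochizukiEtTh2009, Def 3.3 p.72] -/
def cnstMap {Y Y' : ConnectedPart (BTemp Compat)} (f : Y ⟶ Y') : cnstObj Y ⟶ cnstObj Y' :=
  CosetCat.homMk ((toCst (transp f) : Cst) : (cnstObj Y').carrier) fun u hu => by
    rw [MulAction.Quotient.smul_coe, QuotientGroup.eq, smul_eq_mul, mul_inv_rev, mul_comm, mul_inv_cancel_left]
    exact (cnstStab Y').inv_mem (cnstStab_mono f hu)

/-- **The point of `cnst(f)` is `χ(t)` for ANY transporter `t`** (independence of the choice). [cite: MochizukiEtTh2009, Def 3.3 p.72] -/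
theorem pt_cnstMap {Y Y' : ConnectedPart (BTemp Compat)} (f : Y ⟶ Y') {t : Compat}
    (ht : (gset Y').ρ t (bpt Y') = f.hom.hom.hom (bpt Y)) : CosetCat.pt (cnstMap f) = ((toCst t : Cst) : (cnstObj Y').carrier) := by
  rw [cnstMap, CosetCat.pt_homMk]
  exact coe_toCst_eq_of_ρ_eq Y' ((ρ_transp f).trans ht.symm)

/-- **The constant-field functor `D₀ → D^cnst = 𝓑(C)⁰` of the ζ-twisted Kummer–Tate tower**: `Y ↦ Spec K_Y = C/Gal(K̄/K_Y)`, covering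
maps to the induced maps of constant fields (functor laws PROVED; values independent of base points and transporters).
[cite: MochizukiEtTh2009, Def 3.3 p.72] -/
def cnst : ConnectedPart (BTemp Compat) ⥤ CosetCat Cst where
  obj := cnstObj
  map := cnstMap
  map_id Y := CosetCat.hom_ext (by
    rw [pt_cnstMap (𝟙 Y) (t := 1) (by rw [BTempConnected.ρ_one_apply Y.obj]; rfl), map_one, CosetCat.pt_id])
  map_comp {Y Y' Y''} f g := CosetCat.hom_ext (by
    rw [CosetCat.pt_comp, pt_cnstMap f (ρ_transp f), CosetCat.toFun_coe, pt_cnstMap g (ρ_transp g), MulAction.Quotient.smul_coe,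
      smul_eq_mul, ← map_mul, pt_cnstMap (f ≫ g) (t := transp f * transp g)]
    rw [BTempConnected.ρ_mul_apply Y''.obj, ρ_transp g, ← BTempConnected.hom_ρ g.hom, ρ_transp f]
    rfl)

/-- `cnst` on objects. [cite: MochizukiEtTh2009, Def 3.3 p.72] -/
theorem cnst_obj (Y : ConnectedPart (BTemp Compat)) : cnst.obj Y = cnstObj Y := rfl

/-- `cnst` on morphisms. [cite: MochizukiEtTh2009, Def 3.3 p.72] -/
theorem cnst_map {Y Y' : ConnectedPart (BTemp Compat)} (f : Y ⟶ Y') : cnst.map f = cnstMap f := rfl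

/-- The point of `cnst.map f` is `χ(t)` for any transporter `t` of base points. [cite: MochizukiEtTh2009, Def 3.3 p.72] -/
theorem pt_cnst_map {Y Y' : ConnectedPart (BTemp Compat)} (f : Y ⟶ Y') {t : Compat}
    (ht : (gset Y').ρ t (bpt Y') = f.hom.hom.hom (bpt Y)) : CosetCat.pt (cnst.map f) = ((toCst t : Cst) : (cnstObj Y').carrier) :=
  pt_cnstMap f ht

/-- **Criterion for «same image in `D^cnst`»**: two covering maps `g, g' : Y → Y'` with transporters `a, a'` of base points have
`cnst(g) = cnst(g')` iff `χ(a⁻¹a') ∈ Gal(K̄/K_{Y'})`, i.e. iff `a` and `a'` act identically on the constants of `Y'`.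
[cite: MochizukiEtTh2009, Prop 3.4 (ii) p.74] -/
theorem cnst_map_eq_iff {Y Y' : ConnectedPart (BTemp Compat)} (g g' : Y ⟶ Y') {a a' : Compat}
    (ha : (gset Y').ρ a (bpt Y') = g.hom.hom.hom (bpt Y)) (ha' : (gset Y').ρ a' (bpt Y') = g'.hom.hom.hom (bpt Y)) :
    cnst.map g = cnst.map g' ↔ toCst (a⁻¹ * a') ∈ cnstStab Y' := by
  rw [map_mul, map_inv, ← QuotientGroup.eq]
  refine ⟨fun h => ?_, fun h => CosetCat.hom_ext ?_⟩
  · have h' := congrArg CosetCat.pt h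
    rwa [pt_cnst_map g ha, pt_cnst_map g' ha'] at h'
  · rw [pt_cnst_map g ha, pt_cnst_map g' ha']
    exact h

/-- In particular `cnst(g) = cnst(g')` as soon as the transporters have the same constant-field coordinate.
[cite: MochizukiEtTh2009, Prop 3.4 (ii) p.74] -/
theorem cnst_map_eq_of_toCst_eq {Y Y' : ConnectedPart (BTemp Compat)} (g g' : Y ⟶ Y') {a a' : Compat}
    (ha : (gset Y').ρ a (bpt Y') = g.hom.hom.hom (bpt Y)) (ha' : (gset Y').ρ a' (bpt Y') = g'.hom.hom.hom (bpt Y))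
    (h : toCst a = toCst a') : cnst.map g = cnst.map g' := by
  rw [cnst_map_eq_iff g g' ha ha', map_mul, map_inv, h, inv_mul_cancel]
  exact (cnstStab Y').one_mem

end TateTowerKummerTwist

end Literature.AnabelianGeometry.EtaleTheta

end
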